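import Summits.ResolutionOfSingularities.ResolutionOfSingularities.Theorems.EquisingularLiftEquisingularLiftNatNDSNCInv2
import Summits.ResolutionOfSingularities.ResolutionOfSingularities.Theorems.EquisingularLiftEquisingularLiftNatSNCStepAlgebra
import Summits.ResolutionOfSingularities.ResolutionOfSingularities.Theorems.FrobeniusClosingPatchingRelPerfectDepthSNCPointwise
import Summits.ResolutionOfSingularities.ResolutionOfSingularities.Theorems.EquisingularLiftEquisingularLiftNatBoundaryWitnessedCentre
import Summits.ResolutionOfSingularities.ResolutionOfSingularities.Theorems.EquisingularLiftEquisingularLiftNatModelStep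
import Literature.AlgebraicGeometry.Resolution.MarkedIdeals
import Literature.AlgebraicGeometry.Resolution.MonomialMarkedIdeals
import Literature.AlgebraicGeometry.Resolution.SncSaturatedCentre
import Literature.AlgebraicGeometry.Resolution.MarkedIdealsLemmas
import Literature.AlgebraicGeometry.Resolution.AlterationsSectionDivisor
import Literature.AlgebraicGeometry.Resolution.RegularSystemOfParameters
import HarnessLib

/-!
# [OURS · L1 W4.5(b) · EL♮(3) · ND-K5 (B3g)] THE STRATUM FACTS OF THE O-SIDE INVARIANT: `StratumFacts O k θ P q Y Ch (SNCInv₂ P Y)`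

res-L1-w45b-stub-4 g11 (dealt (B3g) by desk R31 «ND-K5»). Crux EL♮(3) = stmt-ResolutionOfSingularities-20148 (parent stmt-…-20038); toward the registered ND stub
`stub_elnat_three_isolated_newtonNondegenerate` through res-L1-w45b-idea-1's K5-native spec `Cruxes/EquisingularLiftNatThree/NewtonNondegenerateRungK5.lean`
v7 219728bb661fa5d3 (§13.2 (B3) `hsub_strataLift` := `ND.hsub_strataLift_of_invariant` ∘ (B3a)/(B3g)/(B3b)). OURS; NOT a statement of any manuscript
([Hironaka2017] is a candidate under adjudication, nothing of it is asserted); AI-written, weaker than expert review. DEF-FREE; no `sorry`; standard axioms.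
`--supports stmt-ResolutionOfSingularities-20148 --as helper`.

WHAT. For every stage tuple `(X, σ, S, F, jm, t, T)` (res-L1-w45b-lead-2's port `ND.StageTuple`, p638808), every pair of boundaries `(EX, E)` with `ND.SNCInv₂ P Y X σ
F jm EX E` (res-L1-w45b-lead-2 `…NatNDSNCInv2` = spec v8 §13.7, the desk's merged re-cut: `IsClosedImmersion jm`, (a) absent rays `⊤`, (b) non-frame members off the generic point of `Y`, (c) `jm.ker :: members` SNC
AT every point of the non-frame exceptional support — `Theorems.DepthSNC.SNCWithAt` —, (c′) there the fibre's germ differs from every member's germ, (d) model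
compatibility) and every face `τ` with a non-frame ray: the upstairs stratum `V(Σ_{ρ∈τ} EX ρ)` is (1) a REGULAR scheme, (2) `O`-FLAT, (3) pulls back to the downstairs
stratum `Σ_{ρ∈τ} E ρ` under `jm`, (4) lies off the generic point of `Y`.
HOW. (i) A point `x` of the upstairs stratum lies in every `V(EX ρ)`, `ρ ∈ τ`; hence every ray of `τ` is PRESENT (an absent ray has `EX ρ = ⊤`, empty support) and —
through the non-frame ray `ρ₀ ∈ τ` — `x` lies in the non-frame exceptional support, where (c)/(c′) speak. (ii) LOCAL PACKAGE at `x`: (c) hands an r.s.p. `v` of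
`𝒪_{X,x}` and injective labels `ι`; the stratum's stalk is `(v '' Sx)`, `Sx = ι(τ)`; if `x ∈ V(jm.ker)`, the fibre's label `i₀ = ι(jm.ker)` is NOT in `Sx` — else the
fibre and a member would be the SAME sheaf (injectivity of `ι` is on sheaves), contradicting (c′) at `x`. (1) `𝒪_{X,x}/(v '' Sx)` is regular
(`isRegularLocalRing_quotient_span_image`; `Scheme.isRegular_subscheme_of_forall`). (2) DVR criterion `CILift.flat_subschemeι_comp_of_forall_stalk`
(res-L1-w45b-lead-1, …NatCompleteIntersectionLiftCentre): at a special point `x = jm g` (`range_eq_preimage_of_isPullback` + `range_specMap_of_surjective_of_field`),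
`(jm.ker)_x = (ϖ_x)` (`stalkIdeal_ker_eq_ker_stalkMap`, `ker_stalkMap_model_le`, `stalkMap_model_varpi` — the users of `hθ`), so `ϖ_x` generates `(v i₀)`, is
not in the PRIME `(v '' Sx)` (`isPrime_span_image`, `not_mem_span_image_of_not_mem`), i.e. `ϖ` is regular modulo the stratum. (3) `comap` distributes over the finite
sup; an absent ray makes both strata `⊤`; otherwise compare STALKS (`le_of_forall_stalkIdeal_le`): non-frame rays by (d) exactly, frame rays by (d) at the points of
`V(E ρ₀)`, off `V(E ρ₀)` both sups are `⊤`. (4) by (b) on `ρ₀`. [cite: Matsumura1987, Thm. 14.2] [cite: Hartshorne1977, III Prop. 9.7]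
[cite: BierstoneGrigorievMilmanWlodarczyk2011, Def. 3.1.1]
-/

set_option linter.dupNamespace false -- mandated namespace `Summit.<Summit>.<Problem>` of this single-conjunct summit
set_option linter.overlappingInstances false -- signatures carry `[IsDomain O] [IsDiscreteValuationRing O]`

noncomputable section

open CategoryTheory CategoryTheory.Limits AlgebraicGeometry TopologicalSpace Topology IsLocalRing
open Literature.AlgebraicGeometry.Resolution
open AlgebraicGeometry.Scheme.IdealSheafData
open Summit.ResolutionOfSingularities.ResolutionOfSingularities.Theorems.DepthSNC

namespace Summit.ResolutionOfSingularities.ResolutionOfSingularities.Cruxes.EquisingularLiftNat.Sections.ND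

variable {n : ℕ}


/-! ## Finite sups of an indexed family of ideal sheaves (`stalkIdeal_finsetSup_fun` / `comap_finsetSup_fun` / `finsetSup_eq_top_of_mem`: res-L1-w45b-stub-2's
`…NatSNCStepAlgebra`, shared with (B3b)) -/

/-- A point of the support of a finite sup lies in the support of every member. [folklore] -/
theorem mem_support_of_mem_support_finsetSup_fun {X : Scheme.{0}} {ι : Type*} {s : Finset ι} {f : ι → X.IdealSheafData}
    {x : X} (hx : x ∈ (s.sup f).support) {i : ι} (hi : i ∈ s) : x ∈ (f i).support :=
  Scheme.IdealSheafData.support_antitone (Finset.le_sup hi) hx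

section B3g

variable (O : Type) [CommRing O] [IsDomain O] [IsDiscreteValuationRing O] (k : Type) [Field k] (θ : O →+* k)
  (hθ : Function.Surjective θ)
  (P : Scheme.{0}) (q : P ⟶ Spec (.of O)) (Y : Set P) (Ch : ∀ X' : Scheme.{0}, (X' ⟶ P) → Set X' → Prop) (n : ℕ)

include hθ in
/-- **(B3g) `sncInv_stratumFacts`** (module docstring): the four centre facts — regular, `O`-flat, pulling back to the downstairs stratum, off the generic point
of `Y` — for every stratum of a face with a non-frame ray, from the O-side invariant `ND.SNCInv₂` (spec v8 §13.7). [cite: Matsumura1987, Thm. 14.2]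
[cite: Hartshorne1977, III Prop. 9.7] [OURS · L1 W4.5b · ND-K5 (B3g)] toward `stub_elnat_three_isolated_newtonNondegenerate`; NOT a statement of the manuscript. -/
theorem sncInv_stratumFacts : StratumFacts (n := n) O k θ P q Y Ch (SNCInv₂ (n := n) P Y) := by
  classical
  intro X σ S F jm t T EX E hSt hI τ hτ hE1T
  obtain ⟨-, hXint, hXnoeth, hXreg, -, hFint, hsq, -, -, -⟩ := hSt
  obtain ⟨-, R, habs, hb, hsnc, hne, hd1, hd2⟩ := hI
  obtain ⟨ρ₀, hρ₀τ, hρ₀nf⟩ := hτ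
  haveI := hXint; haveI := hXnoeth; haveI := hFint
  have hCdef : stratum EX τ = τ.sup EX := rfl
  have hCEdef : stratum E τ = τ.sup E := rfl
  -- (i) a point of the upstairs stratum lies in every member; every ray of `τ` is present; the point lies in the non-frame exceptional support
  have hmem : ∀ x ∈ (stratum EX τ).support, ∀ ρ ∈ τ, x ∈ (EX ρ).support := fun x hx ρ hρ =>
    mem_support_of_mem_support_finsetSup_fun (f := EX) hx hρ
  have hpres : ∀ x ∈ (stratum EX τ).support, ∀ ρ ∈ τ, ρ ∈ R := by
    intro x hx ρ hρ
    by_contra hρR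
    have h := hmem x hx ρ hρ
    rw [(habs ρ hρR).1, Scheme.IdealSheafData.support_top] at h
    exact h
  have hwit : ∀ x ∈ (stratum EX τ).support, ∃ ρ ∈ R, ρ ∉ Set.range (e n) ∧ x ∈ ((EX ρ).support : Set X) := fun x hx =>
    ⟨ρ₀, hpres x hx ρ₀ hρ₀τ, hρ₀nf, hmem x hx ρ₀ hρ₀τ⟩
  -- (ii) THE LOCAL PACKAGE at a point of the stratum: r.s.p. `v`, index set `Sx` with stalk `(v '' Sx)`, and the fibre index `i₀ ∉ Sx`
  have hpkg : ∀ (x : X), x ∈ (stratum EX τ).support →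
      ∃ (hreg : IsRegularLocalRing (X.presheaf.stalk x)) (d : ℕ) (v : Fin d → X.presheaf.stalk x) (Sx : Finset (Fin d)) (i₀ : Fin d),
        (maximalIdeal (X.presheaf.stalk x)).spanFinrank = d ∧ Ideal.span (Set.range v) = maximalIdeal _ ∧
        stalkIdeal (stratum EX τ) x = Ideal.span (v '' (Sx : Set _)) ∧
        (x ∈ jm.ker.support → stalkIdeal jm.ker x = Ideal.span {v i₀} ∧ i₀ ∉ Sx) := by
    intro x hx
    obtain ⟨hreg, d, v, hd, hv, ⟨ι, hιinj, hιD⟩, -⟩ := hsnc x (hwit x hx)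
    have hmemL : ∀ ρ ∈ τ, EX ρ ∈ jm.ker :: (R.toList.map fun ρ => EX ρ) := fun ρ hρ =>
      List.mem_cons_of_mem _ (List.mem_map.mpr ⟨ρ, Finset.mem_toList.mpr (hpres x hx ρ hρ), rfl⟩)
    let idx : τ → Fin d := fun ρ => ι ⟨EX ρ.1, hmemL ρ.1 ρ.2, hmem x hx ρ.1 ρ.2⟩
    let Sx : Finset (Fin d) := Finset.univ.image idx
    have hstalk : stalkIdeal (stratum EX τ) x = Ideal.span (v '' (Sx : Set _)) := by
      rw [hCdef, stalkIdeal_finsetSup_fun]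
      have h1 : (τ.sup fun ρ => stalkIdeal (EX ρ) x) = τ.attach.sup fun ρ => Ideal.span {v (idx ρ)} := by
        rw [← Finset.sup_attach]
        exact Finset.sup_congr rfl fun ρ _ => hιD ⟨EX ρ.1, hmemL ρ.1 ρ.2, hmem x hx ρ.1 ρ.2⟩
      rw [h1, Finset.sup_span_singleton_eq_span_image]
      congr 1
      ext a
      simp only [Sx, Finset.coe_image, Finset.coe_univ, Set.image_univ, Set.mem_image, Finset.mem_coe, Finset.mem_attach,
        true_and, Set.mem_range]
      constructor
      · rintro ⟨y, rfl⟩; exact ⟨_, ⟨y, rfl⟩, rfl⟩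
      · rintro ⟨_, ⟨y, rfl⟩, rfl⟩; exact ⟨y, rfl⟩
    by_cases hxker : x ∈ jm.ker.support
    · let i₀ := ι ⟨jm.ker, List.mem_cons_self .., hxker⟩
      refine ⟨hreg, d, v, Sx, i₀, hd, hv, hstalk, fun _ => ⟨hιD ⟨jm.ker, List.mem_cons_self .., hxker⟩, ?_⟩⟩
      intro hi
      obtain ⟨ρ, -, hρ⟩ := Finset.mem_image.mp hi
      have hEq : EX ρ.1 = jm.ker := Subtype.ext_iff.mp (hιinj hρ)
      exact hne ρ.1 (hpres x hx ρ.1 ρ.2) x (hwit x hx) hxker (hmem x hx ρ.1 ρ.2) (by rw [hEq])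
    · exact ⟨hreg, d, v, Sx, idx ⟨ρ₀, hρ₀τ⟩, hd, hv, hstalk, fun h => absurd h hxker⟩
  obtain ⟨ϖ, hϖ⟩ := IsDiscreteValuationRing.exists_irreducible O
  refine ⟨?_, ?_, ?_, ?_⟩
  · -- (1) REGULARITY: the quotient stalks `𝒪_{X,x}/(v '' Sx)` are regular
    refine Scheme.isRegular_subscheme_of_forall (stratum EX τ) fun x hx => ?_
    obtain ⟨hreg, d, v, Sx, -, hd, hv, hstalk, -⟩ := hpkg x hx
    haveI := hreg
    rw [hstalk]
    exact isRegularLocalRing_quotient_span_image hd v hv Sx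
  · -- (2) FLATNESS over the DVR: `ϖ` is regular modulo the stratum at every special point (the fibre's parameter is NOT among the stratum's)
    refine CILift.flat_subschemeι_comp_of_forall_stalk O (σ ≫ q) (stratum EX τ) ϖ hϖ fun x hx hxs a ha => ?_
    -- the point is special: `x = jm g`, and `(jm.ker)_x = (ϖ_x)`
    have hrange : Set.range jm = (σ ≫ q) ⁻¹' {closedPoint O} := by
      rw [range_eq_preimage_of_isPullback hsq, range_specMap_of_surjective_of_field θ hθ]
    have hxr : x ∈ Set.range jm := by rw [hrange]; exact hxs
    obtain ⟨g, hg⟩ := hxr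
    haveI : IsClosedImmersion (Spec.map (CommRingCat.ofHom θ)) := IsClosedImmersion.spec_of_surjective _ hθ
    haveI : IsClosedImmersion jm := MorphismProperty.IsStableUnderBaseChange.of_isPullback hsq.flip inferInstance
    have hkerx : stalkIdeal jm.ker x = Ideal.span {(X.presheaf.Γgerm x).hom ((σ ≫ q).appTop.hom ((Scheme.ΓSpecIso (.of O)).inv.hom ϖ))} := by
      subst hg
      rw [stalkIdeal_ker_eq_ker_stalkMap jm g]
      refine le_antisymm (ker_stalkMap_model_le O k θ hθ (σ ≫ q) jm t hsq g ϖ hϖ) ?_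
      rw [Ideal.span_le, Set.singleton_subset_iff]
      exact stalkMap_model_varpi θ hθ (σ ≫ q) jm t hsq g ϖ (hϖ.maximalIdeal_eq ▸ Ideal.mem_span_singleton_self ϖ)
    have hxker : x ∈ jm.ker.support := by
      rw [mem_support_iff_stalkIdeal_ne_top, ← hg, stalkIdeal_ker_eq_ker_stalkMap jm g]
      exact RingHom.ker_ne_top _
    obtain ⟨hreg, d, v, Sx, i₀, hd, hv, hstalk, hfib⟩ := hpkg x hx
    obtain ⟨hker0, hi₀⟩ := hfib hxker
    haveI := hreg
    have hprime : (Ideal.span (v '' (Sx : Set _))).IsPrime := isPrime_span_image hd v hv Sx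
    -- `ϖ_x ∉ (v '' Sx)`: else `v i₀ ∈ (ϖ_x) ⊆ (v '' Sx)`, against the minimality of the r.s.p.
    have hnot : (X.presheaf.Γgerm x).hom ((σ ≫ q).appTop.hom ((Scheme.ΓSpecIso (.of O)).inv.hom ϖ)) ∉ Ideal.span (v '' (Sx : Set _)) := by
      intro hmem'
      apply not_mem_span_image_of_not_mem hd v hv (show i₀ ∉ (Sx : Set _) from fun h => hi₀ (Finset.mem_coe.mp h))
      have h1 : v i₀ ∈ stalkIdeal jm.ker x := hker0 ▸ Ideal.mem_span_singleton_self _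
      rw [hkerx] at h1
      exact (Ideal.span_singleton_le_iff_mem _).mpr hmem' h1
    rw [hstalk] at ha ⊢
    exact (hprime.mem_or_mem ha).resolve_left hnot
  · -- (3) MODEL COMPATIBILITY `(stratum EX τ)·𝒪_F = stratum E τ`
    rw [hCdef, hCEdef, comap_finsetSup_fun]
    by_cases hex : ∃ ρ ∈ τ, ρ ∉ R
    · -- an absent ray in `τ`: both strata are `⊤`
      obtain ⟨ρ₁, hρ₁τ, hρ₁R⟩ := hex
      rw [finsetSup_eq_top_of_mem (f := fun ρ => (EX ρ).comap jm) hρ₁τ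
          (by rw [(habs ρ₁ hρ₁R).1, Scheme.IdealSheafData.comap_top]),
        finsetSup_eq_top_of_mem (f := E) hρ₁τ (habs ρ₁ hρ₁R).2]
    · -- every ray present: compare STALKS (non-frame rays exactly by (d), frame rays at the points of `supp (E ρ₀)`, elsewhere both sups are `⊤`)
      have hall : ∀ ρ ∈ τ, ρ ∈ R := fun ρ hρ => by_contra fun h => hex ⟨ρ, hρ, h⟩
      have hst : ∀ y : F, stalkIdeal (τ.sup fun ρ => (EX ρ).comap jm) y = stalkIdeal (τ.sup E) y := by
        intro y
        rw [stalkIdeal_finsetSup_fun, stalkIdeal_finsetSup_fun]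
        by_cases hy : y ∈ (E ρ₀).support
        · refine Finset.sup_congr rfl fun ρ hρ => ?_
          by_cases hρf : ρ ∈ Set.range (e n)
          · obtain ⟨i, rfl⟩ := hρf
            exact hd2 i y ⟨ρ₀, hall ρ₀ hρ₀τ, hρ₀nf, hy⟩
          · rw [hd1 ρ (hall ρ hρ) hρf]
        · have htop : stalkIdeal (E ρ₀) y = ⊤ := by
            by_contra h
            exact hy ((mem_support_iff_stalkIdeal_ne_top _ _).mpr h)
          have h1 : (τ.sup fun ρ => stalkIdeal ((EX ρ).comap jm) y) = ⊤ :=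
            top_le_iff.mp (le_trans (by rw [hd1 ρ₀ (hall ρ₀ hρ₀τ) hρ₀nf, htop])
              (Finset.le_sup (f := fun ρ => stalkIdeal ((EX ρ).comap jm) y) hρ₀τ))
          have h2 : (τ.sup fun ρ => stalkIdeal (E ρ) y) = ⊤ :=
            top_le_iff.mp (le_trans (by rw [htop]) (Finset.le_sup (f := fun ρ => stalkIdeal (E ρ) y) hρ₀τ))
          rw [h1, h2]
      exact le_antisymm (le_of_forall_stalkIdeal_le fun y => (hst y).le) (le_of_forall_stalkIdeal_le fun y => (hst y).ge)
  · -- (4) OFF THE GENERIC POINT of `Y` (through the non-frame ray `ρ₀`)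
    rintro _ ⟨x, hx, rfl⟩
    exact hb ρ₀ (hpres x hx ρ₀ hρ₀τ) hρ₀nf ⟨x, hmem x hx ρ₀ hρ₀τ, rfl⟩

end B3g

end Summit.ResolutionOfSingularities.ResolutionOfSingularities.Cruxes.EquisingularLiftNat.Sections.ND

end
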